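import Mathlib.Data.List.FinRange
import Mathlib.Tactic.Ring
import Literature.Computability.Complexity.CNF
import Literature.Computability.Complexity.CNFRelabel
import Literature.Computability.MetaComplexity.ParisWilkie
import Literature.Computability.MetaComplexity.Frege
import HarnessLib

/-!
# The fixed-format satisfiability formula `SAT_n(X, Y)` (matrix codes of CNFs)

Topic `Literature/Computability/MetaComplexity` (proof complexity), definition request
`satMatrixForm` (lens route SelfProvingEF on Pich–Santhanam, *Towards P ≠ NP from Extended Frege
lower bounds*, J. ACM 73 (2026), §1.2 and §3.2, Thm. 19 / Cor. 20; arXiv:2312.08163 §1.1.1).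

Pich–Santhanam work with "`SAT_n(x, y)`, a p-time predicate saying that `x` is an `n`-bit string
encoding a propositional formula satisfied by assignment `y`" and "do not specify the precise
encoding". For a propositional formalisation in which NO PARSING MACHINE enters the formula we fix
the format of Krajíček, *Proof Complexity* (CUP 2019), §8.4: a clause `C` in the atoms
`p_1, …, p_n` is a subset `C' ⊆ [2n]` (`i ∈ C'` iff `p_i ∈ C`, `n + i ∈ C'` iff `¬p_i ∈ C`), a set of
`m` clauses is a binary relation `F ⊆ [m] × [2n]`, and "`E` satisfies `F`" is the bounded formula
(8.4.1) `Sat_2(x, y) := ∀ j ≤ y ∃ i ≤ x [(E(i) ∧ F(j, i)) ∨ (¬E(i) ∧ F(j, i + x))]`, whose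
propositional translation is a conjunction of disjunctions of the cells
`(f_{j,i} ∧ e_i) ∨ (f_{j,n+i} ∧ ¬e_i)`. We take `m = n` (at most `n` clauses over the variables
`x_0, …, x_{n-1}`; fewer clauses are padded) and interleave the two polarities, so that a code is a
bit string of length `2n²` in row-major order.

## Content

* `CNFMatrix n := Fin n → Fin n → Bool → Bool`, the MATRIX CODE of a CNF with at most `n` clauses
  over the variables `< n`: `m i j true` (resp. `m i j false`) says that clause `i` contains the
  literal `x_j` (resp. `¬x_j`). `CNFMatrix.toCNF m` is the coded CNF `φ_m` (a `CNF ℕ` of the tree,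
  `Complexity/CNF.lean`); `CNFMatrix.ofCNF n φ` codes a CNF with `≤ n` clauses over variables `< n`
  (`IsMatrixCNF n φ`), padding the missing rows by the FULL row (the clause
  `x_0 ∨ ¬x_0 ∨ ⋯`, a tautology); `eval_toCNF_ofCNF`: the round trip preserves the truth value under
  every assignment, hence satisfiability and membership in `SAT` (`encode_toCNF_ofCNF_mem_SAT_iff`);
  `ofCNF_toCNF : ofCNF n (toCNF m) = m`. The padding lemma `IsMatrixCNF.mono`: a CNF in format `n` is
  in format `N` for every `N ≥ n`, with the same truth values (`eval_toCNF_ofCNF` at `N`).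
* The string form: `CNFMatrix.bits m : List Bool` of length `2 n²`, bit number
  `SatMatrix.xVar n i j s = 2 (n i + j) + [s = false]` being `m i j s` (`CNFMatrix.bitAt`,
  `bitAt_xVar`), and `CNFMatrix.ofBits` with `ofBits_bits`; `CNFMatrix.satIndicator n w`, the
  Boolean function "`SAT_n(w)`" of Pich–Santhanam (`= 1 ↔ ∃ y, SAT_n(w, y)`) on `2n²` bits
  (`satIndicator_eq_true_iff`).
* The formula `satMatrixForm n : PropForm ℕ` = `SAT_n(X, Y)` in two disjoint blocks of variables,
  the `2n²` CODE variables `X = {xVar n i j s}` = `[0, 2n²)` and the `n` ASSIGNMENT variables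
  `Y = {yVar n j = 2n² + j}`:
  `⋀_{i<n} ⋁_{j<n} ((x_{i,j,⊤} ∧ y_j) ∨ (x_{i,j,⊥} ∧ ¬y_j))`, built with `PropForm.conjs/disjs`
  (`ParisWilkie.lean`); `size_satMatrixForm : size = 9n² + 2n + 1`; the semantics
  `eval_satMatrixForm`: under `σ` the formula is true iff the assignment read off `Y`
  (`SatMatrix.readAssignment`) satisfies the CNF coded by the matrix read off `X`
  (`SatMatrix.readMatrix`).
* Substituting a concrete code: `SatMatrix.codeSubst m` (the block `X` ↦ the constants `m`, identity
  elsewhere), `satMatrixFormAt m` (the explicit result) and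
  `subst_satMatrixForm_codeSubst : (satMatrixForm n).subst (codeSubst m) = satMatrixFormAt m`;
  `eval_satMatrixFormAt : eval σ = (toCNF m).eval (readAssignment n σ)`. On the CNF side
  `SatMatrix.cnfForm m := PropForm.ofCNF ((toCNF m).relabel (yVar n))` (the clauses of `φ_m` written
  in the block `Y`) and the SEMANTIC ADEQUACY `eval_satMatrixFormAt_eq_eval_cnfForm`,
  `isTautology_biimp_satMatrixFormAt_cnfForm`; consequently
  `isTautology_neg_satMatrixFormAt_iff : (¬ SAT_n(⌜φ⌝, Y)) is a tautology ↔ ¬ φ.Satisfiable` for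
  `φ` in format `n` — the reading used in the p-boundedness step of Pich–Santhanam, Thm. 19 ("to
  prove a tautology `ψ` of size `n` in `EF + w` it suffices to check `¬SAT_n(¬ψ, C(¬ψ))`").

## What is NOT here (scope)

* The PROOF-THEORETIC adequacy — polynomial-size `textbookFrege` proofs of
  `satMatrixFormAt m ↔ cnfForm m` (evaluation of the constant cells, Buss 1987-style) — is the
  business of the sibling proof file `SatMatrixFormFrege.lean`; here only its semantic shadow
  (`isTautology_biimp_satMatrixFormAt_cnfForm`) is recorded.
* Polynomial-time (`FP`) conversions between the string form `bits` and the tree's `encodingCNF`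
  (both directions are plain list recursions: `toCNF ∘ ofBits` and `bits ∘ ofCNF n ∘ decode`), and
  the NP-completeness of `SAT` restricted to matrix codes, are machine constructions left to a
  sibling file; the present file fixes the FORMAT and its semantics only.
* Circuits `C(x)` computing assignments, the witnessing formulas `w^k_n(f)` and the run encoding of
  p-time functions (`runForm`, `psWitnessFormula`) are separate definition items.

## Sources

* J. Pich, R. Santhanam, *Towards P ≠ NP from Extended Frege lower bounds*, J. ACM 73(2) (2026),
  art. 12, §1.2 (the formulas `w^k_n(f)`, `SAT_n(x, y)`), §3.2, Thm. 19 and its proof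
  (p-boundedness from `SAT_n(x, y) → SAT_n(x, C(x))`); arXiv:2312.08163, §1.1.1.
* J. Krajíček, *Proof Complexity*, Encyclopedia Math. Appl. 170, CUP 2019, §8.4 (clauses as subsets
  of `[2n]`, sets of clauses as relations `F ⊆ [m] × [2n]`, the formula `Sat_2`, eq. (8.4.1)).
* J. Krajíček, *Bounded Arithmetic, Propositional Logic, and Complexity Theory*, CUP 1995, §9.3
  (satisfaction formulas and their adequacy, Lemma 9.3.12).
* S. A. Cook, *The complexity of theorem proving procedures*, STOC 1971 (SAT).

## Design choices

* Variables are plain natural numbers in two arithmetic blocks (`xVar`, `yVar`) rather than a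
  structured variable type, because Frege systems of the tree live on `PropForm ℕ` and consumers
  substitute into / rename these blocks (`PropForm.subst`); all index arithmetic is discharged here
  (`bitAt_xVar`, `codeSubst_xVar`, `codeSubst_yVar`, `xVar_lt`, `xVar_injective`-type lemmas).
* Rows and cells are enumerated by `List.finRange n`, so that the pieces of `satMatrixFormAt m` are
  literally indexed by the arguments of `m : CNFMatrix n`.
* Padding by the full row keeps the format total (every CNF with `≤ n` clauses over variables `< n`
  has a code with exactly `n` rows) without an extra "row active" bit; the full row is a tautology
  as soon as `n ≥ 1`, and for `n = 0` there are no rows.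
-/

namespace Literature.Computability.MetaComplexity

open Complexity Complexity.PropForm

/-! ### The variable layout -/

namespace SatMatrix

/-- The CODE variable `x_{i,j,s}` of `SAT_n(X, Y)` ("clause `i` contains the literal `x_j` if
`s = true`, `¬x_j` if `s = false`"), numbered row-major with the two polarities interleaved:
`2 (n i + j) + [s = false]`; for `i, j < n` these are exactly the numbers `< 2n²`.
[cite: Krajicek2019, §8.4 (8.4.1)] -/
def xVar (n i j : ℕ) (s : Bool) : ℕ :=
  2 * (n * i + j) + (!s).toNat

/-- The ASSIGNMENT variable `y_j` of `SAT_n(X, Y)`: the block after the code block, `2n² + j`.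
[cite: Krajicek2019, §8.4 (8.4.1)] -/
def yVar (n j : ℕ) : ℕ :=
  2 * n * n + j

variable {n i j : ℕ}

/-- The polarity offset is a bit. [folklore] -/
theorem toNat_not_lt_two (s : Bool) : (!s).toNat < 2 := by
  cases s <;> simp

/-- Halving a code variable forgets the polarity. [folklore] -/
theorem xVar_div_two (n i j : ℕ) (s : Bool) : xVar n i j s / 2 = n * i + j := by
  have h := toNat_not_lt_two s
  unfold xVar
  omega

/-- The parity of a code variable is the polarity bit. [folklore] -/
theorem xVar_mod_two (n i j : ℕ) (s : Bool) : xVar n i j s % 2 = (!s).toNat := by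
  have h := toNat_not_lt_two s
  unfold xVar
  omega

/-- Recovering the row index. [folklore] -/
theorem xVar_div_two_div (hj : j < n) (i : ℕ) (s : Bool) : xVar n i j s / 2 / n = i := by
  have hn : 0 < n := by omega
  rw [xVar_div_two, Nat.mul_add_div hn, Nat.div_eq_of_lt hj, Nat.add_zero]

/-- Recovering the column index. [folklore] -/
theorem xVar_div_two_mod (hj : j < n) (i : ℕ) (s : Bool) : xVar n i j s / 2 % n = j := by
  rw [xVar_div_two, Nat.mul_add_mod, Nat.mod_eq_of_lt hj]

/-- Recovering the polarity. [folklore] -/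
theorem decide_xVar_mod_two (n i j : ℕ) (s : Bool) : decide (xVar n i j s % 2 = 0) = s := by
  rw [xVar_mod_two]; cases s <;> simp

/-- Code variables of a format-`n` matrix lie in the block `[0, 2n²)`. [folklore] -/
theorem xVar_lt (hi : i < n) (hj : j < n) (s : Bool) : xVar n i j s < 2 * n * n := by
  have h := toNat_not_lt_two s
  have h2 : n * (i + 1) ≤ n * n := Nat.mul_le_mul_left n (Nat.succ_le_of_lt hi)
  have h3 : n * (i + 1) = n * i + n := Nat.mul_succ n i
  have h4 : 2 * n * n = 2 * (n * n) := Nat.mul_assoc 2 n n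
  unfold xVar
  omega

/-- Assignment variables lie above the code block. [folklore] -/
theorem le_yVar (n j : ℕ) : 2 * n * n ≤ yVar n j := Nat.le_add_right _ _

/-- Hence the two blocks are disjoint. [folklore] -/
theorem xVar_ne_yVar (hi : i < n) (hj : j < n) (s : Bool) (j' : ℕ) : xVar n i j s ≠ yVar n j' :=
  Nat.ne_of_lt (Nat.lt_of_lt_of_le (xVar_lt hi hj s) (le_yVar n j'))

/-- `yVar n` is injective. [folklore] -/
theorem yVar_injective (n : ℕ) : Function.Injective (yVar n) :=
  fun _ _ h => Nat.add_left_cancel h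

/-- Code variables determine row, column and polarity (within the format). [folklore] -/
theorem xVar_inj {i' j' : ℕ} {s s' : Bool} (hj : j < n) (hj' : j' < n)
    (h : xVar n i j s = xVar n i' j' s') : i = i' ∧ j = j' ∧ s = s' := by
  refine ⟨?_, ?_, ?_⟩
  · rw [← xVar_div_two_div hj i s, h, xVar_div_two_div hj' i' s']
  · rw [← xVar_div_two_mod hj i s, h, xVar_div_two_mod hj' i' s']
  · rw [← decide_xVar_mod_two n i j s, h, decide_xVar_mod_two n i' j' s']

end SatMatrix

open SatMatrix

/-! ### Matrix codes of CNFs -/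

/-- The MATRIX CODE of a CNF with at most `n` clauses over the variables `x_0, …, x_{n-1}`:
`m i j true = true` iff clause `i` contains the literal `x_j`, `m i j false = true` iff it contains
`¬x_j` (Krajíček's relation `F ⊆ [m] × [2n]` with `m = n` rows and the polarities side by side).
[cite: Krajicek2019, §8.4 (8.4.1)] -/
abbrev CNFMatrix (n : ℕ) : Type :=
  Fin n → Fin n → Bool → Bool

/-- `IsMatrixCNF n φ`: the CNF `φ` (over the variables `ℕ`) fits the format `n` — at most `n`
clauses, all variables `< n`. [cite: Krajicek2019, §8.4] -/
def IsMatrixCNF (n : ℕ) (φ : CNF ℕ) : Prop :=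
  φ.length ≤ n ∧ ∀ c ∈ φ, ∀ l ∈ c, l.1 < n

/-- **Padding lemma** (formats are monotone): a CNF in format `n` is in format `N` for every
`N ≥ n`. [folklore] -/
theorem IsMatrixCNF.mono {n N : ℕ} {φ : CNF ℕ} (h : IsMatrixCNF n φ) (hN : n ≤ N) :
    IsMatrixCNF N φ :=
  ⟨h.1.trans hN, fun c hc l hl => Nat.lt_of_lt_of_le (h.2 c hc l hl) hN⟩

/-- Every CNF fits the format `max (number of clauses) (number of variables)`.
[cite: Krajicek2019, §8.4] -/
theorem isMatrixCNF_max (φ : CNF ℕ) : IsMatrixCNF (max φ.numClauses φ.numVars) φ :=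
  ⟨le_max_left _ _, fun _ hc _ hl =>
    Nat.lt_of_lt_of_le (CNF.lt_numVars_of_mem_of_mem hc hl) (le_max_right _ _)⟩

namespace CNFMatrix

variable {n : ℕ}

/-- The literals contributed by the cell `(i, j)`: `x_j` if `m i j true`, then `¬x_j` if
`m i j false`. [cite: Krajicek2019, §8.4] -/
def cellLits (m : CNFMatrix n) (i j : Fin n) : Clause ℕ :=
  (if m i j true then [((j : ℕ), true)] else []) ++ (if m i j false then [((j : ℕ), false)] else [])

/-- The clause coded by row `i` (cells in increasing order of `j`). [cite: Krajicek2019, §8.4] -/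
def rowClause (m : CNFMatrix n) (i : Fin n) : Clause ℕ :=
  (List.finRange n).flatMap (m.cellLits i)

/-- The CNF `φ_m` coded by the matrix `m`: its `n` row clauses. [cite: Krajicek2019, §8.4] -/
def toCNF (m : CNFMatrix n) : CNF ℕ :=
  (List.finRange n).map m.rowClause

/-- `m.Holds τ`: the assignment `τ` satisfies the coded CNF, read directly off the matrix — every
row has a cell whose literal is made true (the propositional content of Krajíček's `Sat_2`).
[cite: Krajicek2019, §8.4 (8.4.1)] -/
def Holds (m : CNFMatrix n) (τ : ℕ → Bool) : Prop :=
  ∀ i : Fin n, ∃ j : Fin n, (m i j true = true ∧ τ j = true) ∨ (m i j false = true ∧ τ j = false)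

/-- Membership in a cell. [folklore] -/
theorem mem_cellLits_iff (m : CNFMatrix n) (i j : Fin n) (l : Literal ℕ) :
    l ∈ m.cellLits i j ↔ l.1 = j ∧ m i j l.2 = true := by
  rcases l with ⟨v, s⟩
  cases ht : m i j true <;> cases hf : m i j false <;> cases s <;> simp [cellLits, ht, hf]

/-- Membership in a row clause: the literal `(v, s)` occurs in row `i` iff `v = j < n` with
`m i j s = true`. [cite: Krajicek2019, §8.4] -/
theorem mem_rowClause_iff (m : CNFMatrix n) (i : Fin n) (l : Literal ℕ) :
    l ∈ m.rowClause i ↔ ∃ j : Fin n, l.1 = j ∧ m i j l.2 = true := by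
  simp [rowClause, List.mem_flatMap, mem_cellLits_iff, List.mem_finRange]

/-- The value of a cell: `(m i j ⊤ ∧ τ j) ∨ (m i j ⊥ ∧ ¬ τ j)`. [cite: Krajicek2019, §8.4 (8.4.1)] -/
theorem exists_mem_cellLits_eval_iff (m : CNFMatrix n) (i j : Fin n) (τ : ℕ → Bool) :
    (∃ l ∈ m.cellLits i j, Literal.eval τ l = true) ↔
      (m i j true = true ∧ τ j = true) ∨ (m i j false = true ∧ τ j = false) := by
  constructor
  · rintro ⟨⟨v, s⟩, hl, hev⟩
    obtain ⟨hv, hm⟩ := (mem_cellLits_iff m i j _).1 hl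
    simp only at hv hm
    subst hv
    cases s
    · right; exact ⟨hm, by simpa [Literal.eval] using hev⟩
    · left; exact ⟨hm, by simpa [Literal.eval] using hev⟩
  · rintro (⟨hm, hτ⟩ | ⟨hm, hτ⟩)
    · exact ⟨((j : ℕ), true), (mem_cellLits_iff m i j _).2 ⟨rfl, hm⟩, by simp [Literal.eval, hτ]⟩
    · exact ⟨((j : ℕ), false), (mem_cellLits_iff m i j _).2 ⟨rfl, hm⟩, by simp [Literal.eval, hτ]⟩

/-- The value of a row clause. [cite: Krajicek2019, §8.4 (8.4.1)] -/
theorem eval_rowClause_iff (m : CNFMatrix n) (i : Fin n) (τ : ℕ → Bool) :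
    Clause.eval τ (m.rowClause i) = true ↔
      ∃ j : Fin n, (m i j true = true ∧ τ j = true) ∨ (m i j false = true ∧ τ j = false) := by
  rw [Clause.eval, List.any_eq_true]
  constructor
  · rintro ⟨l, hl, hev⟩
    obtain ⟨j, -, hl⟩ := List.mem_flatMap.1 hl
    exact ⟨j, (exists_mem_cellLits_eval_iff m i j τ).1 ⟨l, hl, hev⟩⟩
  · rintro ⟨j, hj⟩
    obtain ⟨l, hl, hev⟩ := (exists_mem_cellLits_eval_iff m i j τ).2 hj
    exact ⟨l, List.mem_flatMap.2 ⟨j, List.mem_finRange j, hl⟩, hev⟩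

/-- **Semantics of the coded CNF**: `φ_m` is true under `τ` iff `m.Holds τ`.
[cite: Krajicek2019, §8.4 (8.4.1)] -/
theorem eval_toCNF_iff (m : CNFMatrix n) (τ : ℕ → Bool) : m.toCNF.eval τ = true ↔ m.Holds τ := by
  rw [CNF.eval_eq_true_iff, toCNF, List.forall_mem_map]
  simp only [List.mem_finRange, true_implies, Holds, eval_rowClause_iff]

/-- The coded CNF has exactly `n` clauses. [cite: Krajicek2019, §8.4] -/
@[simp] theorem length_toCNF (m : CNFMatrix n) : m.toCNF.length = n := by
  simp [toCNF]

/-- The coded CNF fits the format `n`. [cite: Krajicek2019, §8.4] -/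
theorem isMatrixCNF_toCNF (m : CNFMatrix n) : IsMatrixCNF n m.toCNF := by
  refine ⟨(length_toCNF m).le, fun c hc l hl => ?_⟩
  obtain ⟨i, -, rfl⟩ := List.mem_map.1 hc
  obtain ⟨j, hj, -⟩ := (mem_rowClause_iff m i l).1 hl
  rw [hj]; exact j.isLt

/-- The `i`-th clause of the coded CNF is the `i`-th row clause. [folklore] -/
theorem getElem_toCNF (m : CNFMatrix n) (i : Fin n) (h : (i : ℕ) < m.toCNF.length) :
    m.toCNF[(i : ℕ)] = m.rowClause i := by
  simp [toCNF]

/-! ### Coding a CNF -/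

/-- The bit `(i, j, s)` of the code of a CNF `φ`: does clause `i` contain the literal `(x_j, s)`;
rows beyond the clauses of `φ` are PADDING rows, coded by the full row (every literal present).
[cite: Krajicek2019, §8.4] -/
def codeBit (φ : CNF ℕ) (i j : ℕ) (s : Bool) : Bool :=
  if h : i < φ.length then decide (((j, s) : Literal ℕ) ∈ φ[i]) else true

/-- The matrix code (format `n`) of a CNF `φ` with at most `n` clauses over variables `< n`: row
`i < |φ|` codes the clause `φ[i]`; the remaining rows are padded with the full row, a tautological
clause. [cite: Krajicek2019, §8.4] -/
def ofCNF (n : ℕ) (φ : CNF ℕ) : CNFMatrix n := fun i j s =>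
  codeBit φ i j s

/-- A code bit inside the clause list. [folklore] -/
theorem codeBit_of_lt {φ : CNF ℕ} {i : ℕ} (h : i < φ.length) (j : ℕ) (s : Bool) :
    codeBit φ i j s = decide (((j, s) : Literal ℕ) ∈ φ[i]) :=
  dif_pos h

/-- A code bit of a padding row. [folklore] -/
theorem codeBit_of_le {φ : CNF ℕ} {i : ℕ} (h : φ.length ≤ i) (j : ℕ) (s : Bool) :
    codeBit φ i j s = true :=
  dif_neg (Nat.not_lt.2 h)

/-- **Decoding the code of `φ` gives back `φ` up to logical equivalence** (the order of literals is
normalised and padding rows are added): for `φ` in format `n`, `φ_{⌜φ⌝}` and `φ` have the same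
value under every assignment. [cite: Krajicek2019, §8.4 (8.4.1)] -/
theorem eval_toCNF_ofCNF {φ : CNF ℕ} (hφ : IsMatrixCNF n φ) (τ : ℕ → Bool) :
    (toCNF (ofCNF n φ)).eval τ = φ.eval τ := by
  rw [Bool.eq_iff_iff, eval_toCNF_iff, CNF.eval_eq_true_iff]
  constructor
  · intro h c hc
    obtain ⟨k, hk, rfl⟩ := List.getElem_of_mem hc
    have hkn : k < n := Nat.lt_of_lt_of_le hk hφ.1
    obtain ⟨j, hj⟩ := h ⟨k, hkn⟩
    have e : ∀ s, ofCNF n φ ⟨k, hkn⟩ j s = decide ((((j : ℕ), s) : Literal ℕ) ∈ φ[k]) :=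
      fun s => codeBit_of_lt hk j s
    rw [e, e, decide_eq_true_eq, decide_eq_true_eq] at hj
    rw [Clause.eval, List.any_eq_true]
    rcases hj with ⟨hm, hτ⟩ | ⟨hm, hτ⟩
    · exact ⟨_, hm, by simp [Literal.eval, hτ]⟩
    · exact ⟨_, hm, by simp [Literal.eval, hτ]⟩
  · intro h i
    by_cases hi : (i : ℕ) < φ.length
    · have hc : φ[(i : ℕ)] ∈ φ := List.getElem_mem hi
      have hcl := h _ hc
      rw [Clause.eval, List.any_eq_true] at hcl
      obtain ⟨⟨v, s⟩, hl, hev⟩ := hcl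
      have hv : v < n := hφ.2 _ hc _ hl
      refine ⟨⟨v, hv⟩, ?_⟩
      have e : ∀ s', ofCNF n φ i ⟨v, hv⟩ s' = decide (((v, s') : Literal ℕ) ∈ φ[(i : ℕ)]) :=
        fun s' => codeBit_of_lt hi v s'
      cases s
      · right; exact ⟨by rw [e, decide_eq_true_eq]; exact hl, by simpa [Literal.eval] using hev⟩
      · left; exact ⟨by rw [e, decide_eq_true_eq]; exact hl, by simpa [Literal.eval] using hev⟩
    · have hn : 0 < n := i.pos
      refine ⟨⟨0, hn⟩, ?_⟩
      have e : ∀ s', ofCNF n φ i ⟨0, hn⟩ s' = true :=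
        fun s' => codeBit_of_le (Nat.not_lt.1 hi) 0 s'
      cases τ 0
      · right; exact ⟨e false, rfl⟩
      · left; exact ⟨e true, rfl⟩

/-- Hence coding preserves satisfiability. [cite: Krajicek2019, §8.4] -/
theorem satisfiable_toCNF_ofCNF_iff {φ : CNF ℕ} (hφ : IsMatrixCNF n φ) :
    (toCNF (ofCNF n φ)).Satisfiable ↔ φ.Satisfiable := by
  simp only [CNF.Satisfiable, eval_toCNF_ofCNF hφ]

/-- **`SAT` restricted to matrix codes**: the normalised CNF `φ_{⌜φ⌝}` is in `SAT` iff `φ` is — the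
padding lemma in language form (with `IsMatrixCNF.mono`, any format `N ≥ n` may be used).
[cite: Cook1971, Thm 1] -/
theorem encode_toCNF_ofCNF_mem_SAT_iff {φ : CNF ℕ} (hφ : IsMatrixCNF n φ) :
    encodingCNF.encode (toCNF (ofCNF n φ)) ∈ SAT ↔ encodingCNF.encode φ ∈ SAT := by
  rw [mem_SAT_iff, mem_SAT_iff, satisfiable_toCNF_ofCNF_iff hφ]

/-- Coding the decoded CNF gives back the matrix exactly. [cite: Krajicek2019, §8.4] -/
theorem ofCNF_toCNF (m : CNFMatrix n) : ofCNF n m.toCNF = m := by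
  funext i j s
  have hi : (i : ℕ) < m.toCNF.length := by simp
  have e : ofCNF n m.toCNF i j s = decide ((((j : ℕ), s) : Literal ℕ) ∈ m.toCNF[(i : ℕ)]) :=
    codeBit_of_lt hi j s
  rw [e, getElem_toCNF m i hi, Bool.eq_iff_iff, decide_eq_true_iff, mem_rowClause_iff]
  constructor
  · rintro ⟨j', hj', hm⟩
    have : j = j' := Fin.ext hj'
    subst this; exact hm
  · intro h; exact ⟨j, rfl, h⟩

/-! ### The string form -/

/-- The bit of the code `m` at position `v`: for `v = xVar n i j s` it is `m i j s` (`bitAt_xVar`);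
other positions read some bit of `m` or `false` (irrelevant). [cite: Krajicek2019, §8.4] -/
def bitAt (m : CNFMatrix n) (v : ℕ) : Bool :=
  if h : 0 < n then
    haveI : NeZero n := NeZero.of_pos h
    m (Fin.ofNat n (v / 2 / n)) (Fin.ofNat n (v / 2 % n)) (decide (v % 2 = 0))
  else false

/-- The STRING FORM of a matrix code: `2n²` bits, row-major, polarities interleaved
(bit `2 (n i + j) + [s = false]` is `m i j s`). [cite: Krajicek2019, §8.4] -/
def bits (m : CNFMatrix n) : List Bool :=
  (List.range (2 * n * n)).map m.bitAt

/-- Reading a matrix code off a bit string (missing bits read `false`). [cite: Krajicek2019, §8.4] -/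
def ofBits (n : ℕ) (w : List Bool) : CNFMatrix n := fun i j s =>
  w.getD (xVar n i j s) false

/-- The string form has length `2n²`. [cite: Krajicek2019, §8.4] -/
@[simp] theorem length_bits (m : CNFMatrix n) : m.bits.length = 2 * n * n := by
  simp [bits]

/-- The bit at the position of `x_{i,j,s}` is `m i j s`. [cite: Krajicek2019, §8.4] -/
theorem bitAt_xVar (m : CNFMatrix n) (i j : Fin n) (s : Bool) :
    m.bitAt (xVar n i j s) = m i j s := by
  have hn : 0 < n := j.pos
  haveI : NeZero n := NeZero.of_pos hn
  simp only [bitAt, dif_pos hn, xVar_div_two_div j.isLt, xVar_div_two_mod j.isLt,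
    decide_xVar_mod_two, Fin.ofNat_val_eq_self]

/-- The bits of the string form. [cite: Krajicek2019, §8.4] -/
theorem getElem?_bits (m : CNFMatrix n) {v : ℕ} (hv : v < 2 * n * n) :
    m.bits[v]? = some (m.bitAt v) := by
  simp [bits, List.getElem?_range hv]

/-- **Round trip**: reading the string form gives back the matrix. [cite: Krajicek2019, §8.4] -/
theorem ofBits_bits (m : CNFMatrix n) : ofBits n m.bits = m := by
  funext i j s
  have hlt : xVar n i j s < 2 * n * n := xVar_lt i.isLt j.isLt s
  simp only [ofBits, List.getD_eq_getElem?_getD, getElem?_bits m hlt, Option.getD_some, bitAt_xVar]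

/-! ### Satisfiability of a code is a finite check -/

/-- Only the values of `τ` below `n` matter for `m.Holds τ`. [folklore] -/
theorem holds_congr (m : CNFMatrix n) {τ τ' : ℕ → Bool} (h : ∀ v < n, τ v = τ' v) :
    m.Holds τ ↔ m.Holds τ' := by
  unfold Holds
  simp only [h _ (Fin.isLt _)]

/-- `m.Holds` on an assignment of the `n` format variables (extended by `false`). [folklore] -/
def HoldsFin (m : CNFMatrix n) (τ : Fin n → Bool) : Prop :=
  m.Holds fun v => if h : v < n then τ ⟨v, h⟩ else false

/-- `HoldsFin` is a finite check. [folklore] -/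
instance decidableHoldsFin (m : CNFMatrix n) (τ : Fin n → Bool) : Decidable (m.HoldsFin τ) := by
  unfold HoldsFin Holds; infer_instance

/-- Satisfiability of the coded CNF is the existence of a satisfying assignment to the `n` format
variables. [cite: Cook1971, Thm 1] -/
theorem satisfiable_toCNF_iff (m : CNFMatrix n) :
    m.toCNF.Satisfiable ↔ ∃ τ : Fin n → Bool, m.HoldsFin τ := by
  constructor
  · rintro ⟨τ, hτ⟩
    refine ⟨fun j => τ j, ?_⟩
    rw [eval_toCNF_iff] at hτ
    refine (holds_congr m fun v hv => ?_).1 hτ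
    simp [hv]
  · rintro ⟨τ, hτ⟩
    exact ⟨_, (eval_toCNF_iff m _).2 hτ⟩

/-- Satisfiability of a coded CNF is decidable (a finite search; no instance is registered on
`CNF.Satisfiable` in general, cf. `CNF.lean`). [cite: Cook1971, Thm 1] -/
def decidableSatisfiableToCNF (m : CNFMatrix n) : Decidable m.toCNF.Satisfiable :=
  decidable_of_iff _ (satisfiable_toCNF_iff m).symm

/-- **`SAT_n` as a Boolean function** of the `2n²` code bits (Pich–Santhanam's `SAT_n(z) ∈ {0,1}`,
"`SAT_n(z) = 1 ⇔ ∃ y, SAT_n(z, y)`"): the indicator of satisfiability of the coded CNF.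
[cite: PichSanthanam2026, §1.2] -/
def satIndicator (n : ℕ) (w : List Bool) : Bool :=
  @decide _ (decidableSatisfiableToCNF (ofBits n w))

/-- `satIndicator n w = true` iff the CNF coded by `w` is satisfiable. [cite: PichSanthanam2026, §1.2] -/
theorem satIndicator_eq_true_iff (n : ℕ) (w : List Bool) :
    satIndicator n w = true ↔ (ofBits n w).toCNF.Satisfiable := by
  simp [satIndicator]

end CNFMatrix

/-! ### The formula `SAT_n(X, Y)` -/

/-- Bounded `∃` over a mapped list. [folklore] -/
private theorem exists_mem_map_iff {α β : Type} {f : α → β} {l : List α} {P : β → Prop} :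
    (∃ b ∈ l.map f, P b) ↔ ∃ a ∈ l, P (f a) := by
  constructor
  · rintro ⟨b, hb, hP⟩
    obtain ⟨a, ha, rfl⟩ := List.mem_map.1 hb
    exact ⟨a, ha, hP⟩
  · rintro ⟨a, ha, hP⟩
    exact ⟨f a, List.mem_map.2 ⟨a, ha, rfl⟩, hP⟩

/-- Sums of a constant over a list. [folklore] -/
private theorem sum_map_const_nat {α : Type} (l : List α) (c : ℕ) :
    (l.map fun _ => c).sum = l.length * c := by
  induction l with
  | nil => simp
  | cons a l ih => simp only [List.map_cons, List.sum_cons, List.length_cons, ih]; ring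

namespace SatMatrix

/-- The cell `(i, j)` of `SAT_n(X, Y)`: `(x_{i,j,⊤} ∧ y_j) ∨ (x_{i,j,⊥} ∧ ¬y_j)` ("clause `i`
contains a literal on `x_j` made true by `y`"). [cite: Krajicek2019, §8.4 (8.4.1)] -/
def cell (n i j : ℕ) : PropForm ℕ :=
  disj (conj (var (xVar n i j true)) (var (yVar n j)))
    (conj (var (xVar n i j false)) (neg (var (yVar n j))))

/-- The row `i` of `SAT_n(X, Y)`: `⋁_{j<n} cell n i j` ("clause `i` is satisfied by `y`").
[cite: Krajicek2019, §8.4 (8.4.1)] -/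
def row (n : ℕ) (i : Fin n) : PropForm ℕ :=
  disjs ((List.finRange n).map fun j : Fin n => cell n i j)

end SatMatrix

/-- **The satisfiability formula `SAT_n(X, Y)`** in the fixed matrix format: over the code
variables `X = {xVar n i j s}` (`2n²` of them) and the assignment variables `Y = {yVar n j}` (`n` of
them), `⋀_{i<n} ⋁_{j<n} ((x_{i,j,⊤} ∧ y_j) ∨ (x_{i,j,⊥} ∧ ¬y_j))` — "the assignment `Y` satisfies
the CNF coded by `X`": the propositional translation of Krajíček's `Sat_2` (8.4.1) at `m = n`,
serving as the `SAT_n(x, y)` of Pich–Santhanam. [cite: Krajicek2019, §8.4 (8.4.1)]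
[cite: PichSanthanam2026, §1.2] -/
def satMatrixForm (n : ℕ) : PropForm ℕ :=
  conjs ((List.finRange n).map (SatMatrix.row n))

namespace SatMatrix

variable {n : ℕ}

/-- The matrix read off the code block of an assignment `σ` to all variables. [folklore] -/
def readMatrix (n : ℕ) (σ : ℕ → Bool) : CNFMatrix n := fun i j s => σ (xVar n i j s)

/-- The assignment to `x_0, …` read off the block `Y` of `σ`. [folklore] -/
def readAssignment (n : ℕ) (σ : ℕ → Bool) : ℕ → Bool := fun v => σ (yVar n v)

/-- Truth table of a cell. [cite: Krajicek2019, §8.4 (8.4.1)] -/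
theorem eval_cell_iff (σ : ℕ → Bool) (n i j : ℕ) :
    (cell n i j).eval σ = true ↔
      (σ (xVar n i j true) = true ∧ σ (yVar n j) = true) ∨
        (σ (xVar n i j false) = true ∧ σ (yVar n j) = false) := by
  simp [cell, PropForm.eval]

/-- Truth table of a row. [cite: Krajicek2019, §8.4 (8.4.1)] -/
theorem eval_row_iff (σ : ℕ → Bool) (i : Fin n) :
    (row n i).eval σ = true ↔ ∃ j : Fin n,
      (σ (xVar n i j true) = true ∧ σ (yVar n j) = true) ∨
        (σ (xVar n i j false) = true ∧ σ (yVar n j) = false) := by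
  rw [row, eval_disjs, exists_mem_map_iff]
  simp only [List.mem_finRange, true_and, eval_cell_iff]

/-- A cell has size `8`. [folklore] -/
theorem size_cell (n i j : ℕ) : (cell n i j).size = 8 := by
  simp [cell, size]

/-- A row has size `9n + 1`. [folklore] -/
theorem size_row (i : Fin n) : (row n i).size = 9 * n + 1 := by
  rw [row, size_disjs, List.map_map]
  simp only [Function.comp_def, size_cell, sum_map_const_nat, List.length_finRange]
  ring

end SatMatrix

section Semantics

variable {n : ℕ}

/-- Truth table of `SAT_n(X, Y)`, cell by cell. [cite: Krajicek2019, §8.4 (8.4.1)] -/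
theorem eval_satMatrixForm_iff (σ : ℕ → Bool) :
    (satMatrixForm n).eval σ = true ↔ ∀ i : Fin n, ∃ j : Fin n,
      (σ (xVar n i j true) = true ∧ σ (yVar n j) = true) ∨
        (σ (xVar n i j false) = true ∧ σ (yVar n j) = false) := by
  rw [satMatrixForm, eval_conjs, List.forall_mem_map]
  simp only [List.mem_finRange, true_implies, SatMatrix.eval_row_iff]

/-- **Semantics of `SAT_n(X, Y)`**: under `σ`, the formula is true iff the assignment read off the
block `Y` satisfies the CNF `φ_m` coded by the matrix `m` read off the block `X`.
[cite: Krajicek2019, §8.4 (8.4.1)] [cite: PichSanthanam2026, §1.2] -/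
theorem eval_satMatrixForm (σ : ℕ → Bool) :
    (satMatrixForm n).eval σ = (readMatrix n σ).toCNF.eval (readAssignment n σ) := by
  rw [Bool.eq_iff_iff, eval_satMatrixForm_iff, CNFMatrix.eval_toCNF_iff]
  rfl

/-- **Size of `SAT_n(X, Y)`**: exactly `9n² + 2n + 1` symbols (each cell has size `8`).
[cite: Krajicek2019, §8.4] -/
theorem size_satMatrixForm (n : ℕ) : (satMatrixForm n).size = 9 * n * n + 2 * n + 1 := by
  rw [satMatrixForm, size_conjs, List.map_map]
  simp only [Function.comp_def, SatMatrix.size_row, sum_map_const_nat, List.length_finRange]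
  ring

/-- Variables of a big conjunction. [folklore] -/
theorem mem_vars_conjs_iff {v : ℕ} (l : List (PropForm ℕ)) :
    v ∈ (conjs l).vars ↔ ∃ φ ∈ l, v ∈ φ.vars := by
  induction l with
  | nil => simp [conjs, vars]
  | cons φ l ih => simp [conjs, vars, ih]

/-- Variables of a big disjunction. [folklore] -/
theorem mem_vars_disjs_iff {v : ℕ} (l : List (PropForm ℕ)) :
    v ∈ (disjs l).vars ↔ ∃ φ ∈ l, v ∈ φ.vars := by
  induction l with
  | nil => simp [disjs, vars]
  | cons φ l ih => simp [disjs, vars, ih]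

/-- **The variables of `SAT_n(X, Y)`** are the code variables `xVar n i j s` and the assignment
variables `yVar n j` (`i, j < n`). [cite: Krajicek2019, §8.4 (8.4.1)] -/
theorem mem_vars_satMatrixForm_iff {v : ℕ} :
    v ∈ (satMatrixForm n).vars ↔
      ∃ i j : Fin n, v = xVar n i j true ∨ v = xVar n i j false ∨ v = yVar n j := by
  constructor
  · intro hv
    rw [satMatrixForm, mem_vars_conjs_iff] at hv
    obtain ⟨φ, hφ, hv⟩ := hv
    obtain ⟨i, -, rfl⟩ := List.mem_map.1 hφ
    rw [SatMatrix.row, mem_vars_disjs_iff] at hv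
    obtain ⟨ψ, hψ, hv⟩ := hv
    obtain ⟨j, -, rfl⟩ := List.mem_map.1 hψ
    refine ⟨i, j, ?_⟩
    simp only [SatMatrix.cell, vars, Finset.mem_union, Finset.mem_singleton] at hv
    tauto
  · rintro ⟨i, j, h⟩
    rw [satMatrixForm, mem_vars_conjs_iff]
    refine ⟨_, List.mem_map.2 ⟨i, List.mem_finRange i, rfl⟩, ?_⟩
    rw [SatMatrix.row, mem_vars_disjs_iff]
    refine ⟨_, List.mem_map.2 ⟨j, List.mem_finRange j, rfl⟩, ?_⟩
    simp only [SatMatrix.cell, vars, Finset.mem_union, Finset.mem_singleton]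
    tauto

/-- Hence every variable of `SAT_n(X, Y)` is `< 2n² + n` (fresh variables for extension axioms may
be taken above). [folklore] -/
theorem lt_of_mem_vars_satMatrixForm {v : ℕ} (hv : v ∈ (satMatrixForm n).vars) :
    v < 2 * n * n + n := by
  obtain ⟨i, j, h⟩ := mem_vars_satMatrixForm_iff.1 hv
  have hx := fun s => xVar_lt (n := n) i.isLt j.isLt s
  rcases h with rfl | rfl | rfl
  · exact Nat.lt_of_lt_of_le (hx true) (Nat.le_add_right _ _)
  · exact Nat.lt_of_lt_of_le (hx false) (Nat.le_add_right _ _)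
  · simp only [yVar]; have := j.isLt; omega

end Semantics

/-! ### Substituting a concrete code for the block `X` -/

namespace SatMatrix

variable {n : ℕ}

/-- The substitution `X := m`: every code variable `v < 2n²` goes to the constant `m.bitAt v`
(so `xVar n i j s ↦ const (m i j s)`), every other variable stays. [cite: PichSanthanam2026, §3.2
(substituting the code of `¬φ` for `x` in `SAT_n(x, y)`)] -/
def codeSubst (m : CNFMatrix n) (v : ℕ) : PropForm ℕ :=
  if v < 2 * n * n then const (m.bitAt v) else var v

/-- `codeSubst` on a code variable. [folklore] -/
theorem codeSubst_xVar (m : CNFMatrix n) (i j : Fin n) (s : Bool) :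
    codeSubst m (xVar n i j s) = const (m i j s) := by
  simp [codeSubst, xVar_lt i.isLt j.isLt s, CNFMatrix.bitAt_xVar]

/-- `codeSubst` is the identity outside the code block. [folklore] -/
theorem codeSubst_of_le (m : CNFMatrix n) {v : ℕ} (hv : 2 * n * n ≤ v) : codeSubst m v = var v := by
  simp [codeSubst, Nat.not_lt.2 hv]

/-- `codeSubst` on an assignment variable. [folklore] -/
theorem codeSubst_yVar (m : CNFMatrix n) (j : ℕ) : codeSubst m (yVar n j) = var (yVar n j) :=
  codeSubst_of_le m (le_yVar n j)

/-- The cell `(i, j)` of `SAT_n(m, Y)`: `(m_{i,j,⊤} ∧ y_j) ∨ (m_{i,j,⊥} ∧ ¬y_j)` with CONSTANTS in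
place of the code variables. [cite: PichSanthanam2026, §3.2] -/
def cellAt (m : CNFMatrix n) (i j : Fin n) : PropForm ℕ :=
  disj (conj (const (m i j true)) (var (yVar n j)))
    (conj (const (m i j false)) (neg (var (yVar n j))))

/-- The row `i` of `SAT_n(m, Y)`. [cite: PichSanthanam2026, §3.2] -/
def rowAt (m : CNFMatrix n) (i : Fin n) : PropForm ℕ :=
  disjs ((List.finRange n).map (cellAt m i))

/-- The CNF side: the clauses of `φ_m` written in the block `Y`, as a formula
(`PropForm.ofCNF` of the relabelled CNF). [cite: PichSanthanam2026, §3.2] -/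
def cnfForm (m : CNFMatrix n) : PropForm ℕ :=
  PropForm.ofCNF (m.toCNF.relabel (yVar n))

/-- Substitution commutes with big conjunctions. [folklore] -/
theorem subst_conjs (σ : ℕ → PropForm ℕ) (l : List (PropForm ℕ)) :
    (conjs l).subst σ = conjs (l.map (PropForm.subst σ)) := by
  induction l with
  | nil => rfl
  | cons φ l ih => simp [conjs, PropForm.subst, ih]

/-- Substitution commutes with big disjunctions. [folklore] -/
theorem subst_disjs (σ : ℕ → PropForm ℕ) (l : List (PropForm ℕ)) :
    (disjs l).subst σ = disjs (l.map (PropForm.subst σ)) := by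
  induction l with
  | nil => rfl
  | cons φ l ih => simp [disjs, PropForm.subst, ih]

/-- Substituting the code into a cell. [folklore] -/
theorem subst_cell_codeSubst (m : CNFMatrix n) (i j : Fin n) :
    (cell n i j).subst (codeSubst m) = cellAt m i j := by
  simp [cell, cellAt, PropForm.subst, codeSubst_xVar, codeSubst_yVar]

/-- Substituting the code into a row. [folklore] -/
theorem subst_row_codeSubst (m : CNFMatrix n) (i : Fin n) :
    (row n i).subst (codeSubst m) = rowAt m i := by
  rw [row, rowAt, subst_disjs, List.map_map]
  congr 1
  exact List.map_congr_left fun j _ => subst_cell_codeSubst m i j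

/-- Truth table of a substituted cell. [folklore] -/
theorem eval_cellAt_iff (m : CNFMatrix n) (σ : ℕ → Bool) (i j : Fin n) :
    (cellAt m i j).eval σ = true ↔
      (m i j true = true ∧ σ (yVar n j) = true) ∨ (m i j false = true ∧ σ (yVar n j) = false) := by
  simp [cellAt, PropForm.eval]

/-- Truth table of a substituted row. [folklore] -/
theorem eval_rowAt_iff (m : CNFMatrix n) (σ : ℕ → Bool) (i : Fin n) :
    (rowAt m i).eval σ = true ↔ ∃ j : Fin n,
      (m i j true = true ∧ σ (yVar n j) = true) ∨ (m i j false = true ∧ σ (yVar n j) = false) := by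
  rw [rowAt, eval_disjs, exists_mem_map_iff]
  simp only [List.mem_finRange, true_and, eval_cellAt_iff]

/-- Semantics of the CNF side: `cnfForm m` is `φ_m` evaluated on the block `Y`.
[cite: PichSanthanam2026, §3.2] -/
theorem eval_cnfForm (m : CNFMatrix n) (σ : ℕ → Bool) :
    (cnfForm m).eval σ = m.toCNF.eval (readAssignment n σ) := by
  rw [cnfForm, eval_ofCNF, CNF.eval_relabel]
  rfl

end SatMatrix

/-- **`SAT_n(m, Y)`**: the satisfiability formula with the concrete code `m` substituted for the
block `X` — `⋀_{i<n} ⋁_{j<n} ((m_{i,j,⊤} ∧ y_j) ∨ (m_{i,j,⊥} ∧ ¬y_j))`, constants in the code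
positions (`subst_satMatrixForm_codeSubst`). [cite: PichSanthanam2026, §3.2] -/
def satMatrixFormAt {n : ℕ} (m : CNFMatrix n) : PropForm ℕ :=
  conjs ((List.finRange n).map (SatMatrix.rowAt m))

section Instances

variable {n : ℕ}

/-- **`(satMatrixForm n)[X := m] = satMatrixFormAt m`.** [cite: PichSanthanam2026, §3.2] -/
theorem subst_satMatrixForm_codeSubst (m : CNFMatrix n) :
    (satMatrixForm n).subst (codeSubst m) = satMatrixFormAt m := by
  rw [satMatrixForm, satMatrixFormAt, SatMatrix.subst_conjs, List.map_map]
  congr 1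
  exact List.map_congr_left fun i _ => SatMatrix.subst_row_codeSubst m i

/-- Truth table of `SAT_n(m, Y)`: it holds under `σ` iff the assignment read off `Y` satisfies the
code `m`. [cite: Krajicek2019, §8.4 (8.4.1)] -/
theorem eval_satMatrixFormAt_iff (m : CNFMatrix n) (σ : ℕ → Bool) :
    (satMatrixFormAt m).eval σ = true ↔ m.Holds (readAssignment n σ) := by
  rw [satMatrixFormAt, eval_conjs, List.forall_mem_map]
  simp only [List.mem_finRange, true_implies, SatMatrix.eval_rowAt_iff, CNFMatrix.Holds,
    readAssignment]

/-- **Semantics of `SAT_n(m, Y)`**: its value under `σ` is the value of the coded CNF `φ_m` under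
the assignment read off `Y`. [cite: Krajicek2019, §8.4 (8.4.1)] [cite: PichSanthanam2026, §3.2] -/
theorem eval_satMatrixFormAt (m : CNFMatrix n) (σ : ℕ → Bool) :
    (satMatrixFormAt m).eval σ = m.toCNF.eval (readAssignment n σ) := by
  rw [Bool.eq_iff_iff, eval_satMatrixFormAt_iff, CNFMatrix.eval_toCNF_iff]

/-- The value of `SAT_n(X, Y)` under `σ` is the value of its instance at the matrix read off `X`.
[folklore] -/
theorem eval_satMatrixForm_eq_eval_satMatrixFormAt (σ : ℕ → Bool) :
    (satMatrixForm n).eval σ = (satMatrixFormAt (readMatrix n σ)).eval σ := by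
  rw [eval_satMatrixForm, eval_satMatrixFormAt]

/-- **Semantic adequacy of the matrix format**: `SAT_n(m, Y)` and the clauses of `φ_m` over `Y`
have the same truth table. (The proof-theoretic form — short Frege proofs of the equivalence — is
the business of `SatMatrixFormFrege.lean`.) [cite: Krajicek1995, Lemma 9.3.12] -/
theorem eval_satMatrixFormAt_eq_eval_cnfForm (m : CNFMatrix n) (σ : ℕ → Bool) :
    (satMatrixFormAt m).eval σ = (cnfForm m).eval σ := by
  rw [eval_satMatrixFormAt, SatMatrix.eval_cnfForm]

/-- Hence `SAT_n(m, Y) ↔ φ_m(Y)` is a tautology. [cite: Krajicek1995, Lemma 9.3.12] -/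
theorem isTautology_biimp_satMatrixFormAt_cnfForm (m : CNFMatrix n) :
    (biimp (satMatrixFormAt m) (cnfForm m)).IsTautology := by
  intro σ
  rw [eval_biimp, eval_satMatrixFormAt_eq_eval_cnfForm]
  simp

/-- `SAT_n(m, Y)` is satisfiable iff the coded CNF is. [cite: Cook1971, Thm 1] -/
theorem satisfiable_satMatrixFormAt_iff (m : CNFMatrix n) :
    (satMatrixFormAt m).Satisfiable ↔ m.toCNF.Satisfiable := by
  constructor
  · rintro ⟨σ, hσ⟩
    exact ⟨readAssignment n σ, by rwa [← eval_satMatrixFormAt]⟩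
  · rintro ⟨τ, hτ⟩
    refine ⟨fun v => τ (v - 2 * n * n), ?_⟩
    rw [eval_satMatrixFormAt]
    convert hτ using 2
    funext v
    simp [readAssignment, yVar]

/-- **The reading used by Pich–Santhanam's p-boundedness step**: for a CNF `φ` in format `n`,
`¬ SAT_n(⌜φ⌝, Y)` is a tautology iff `φ` is unsatisfiable ("to prove a tautology `ψ` … it
suffices to check `¬SAT_n(¬ψ, C(¬ψ))`, which implies that `SAT_n(ψ, y)` and `ψ` hold").
[cite: PichSanthanam2026, §3.2 Thm 19 (proof)] -/
theorem isTautology_neg_satMatrixFormAt_iff {φ : CNF ℕ} (hφ : IsMatrixCNF n φ) :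
    (neg (satMatrixFormAt (CNFMatrix.ofCNF n φ))).IsTautology ↔ ¬ φ.Satisfiable := by
  rw [← CNFMatrix.satisfiable_toCNF_ofCNF_iff hφ, ← satisfiable_satMatrixFormAt_iff]
  simp [IsTautology, PropForm.Satisfiable, PropForm.eval]

/-- The variables of `SAT_n(m, Y)` are assignment variables `yVar n j`, `j < n`.
[cite: PichSanthanam2026, §3.2] -/
theorem mem_vars_satMatrixFormAt_iff (m : CNFMatrix n) {v : ℕ} :
    v ∈ (satMatrixFormAt m).vars ↔ ∃ j : Fin n, v = yVar n j := by
  constructor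
  · intro hv
    rw [satMatrixFormAt, mem_vars_conjs_iff] at hv
    obtain ⟨φ, hφ, hv⟩ := hv
    obtain ⟨i, -, rfl⟩ := List.mem_map.1 hφ
    rw [SatMatrix.rowAt, mem_vars_disjs_iff] at hv
    obtain ⟨ψ, hψ, hv⟩ := hv
    obtain ⟨j, -, rfl⟩ := List.mem_map.1 hψ
    refine ⟨j, ?_⟩
    simp [SatMatrix.cellAt, vars] at hv
    exact hv
  · rintro ⟨j, rfl⟩
    rw [satMatrixFormAt, mem_vars_conjs_iff]
    refine ⟨_, List.mem_map.2 ⟨⟨0, j.pos⟩, List.mem_finRange _, rfl⟩, ?_⟩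
    rw [SatMatrix.rowAt, mem_vars_disjs_iff]
    refine ⟨_, List.mem_map.2 ⟨j, List.mem_finRange j, rfl⟩, ?_⟩
    simp [SatMatrix.cellAt, vars]

end Instances

end Literature.Computability.MetaComplexity
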